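import Summits.BirchSwinnertonDyer.BirchSwinnertonDyer.Theses.SignedLowerHalves
import Summits.BirchSwinnertonDyer.BirchSwinnertonDyer.Theorems.SignedLowerHalvesSmallImageLowerHalfBothSignsLambdaLowerThreeNsThetaTransportCrux
import Literature.NumberTheory.EllipticCurves.NewformGaloisRepArtinConductor
import Literature.NumberTheory.EllipticCurves.HasseWeilAbelianConductorOggSaito
import Literature.NumberTheory.EllipticCurves.EisensteinNewformLevelRaising
import HarnessLib

/-!
# v2 (width seat `bsd-line-slh-p3-w3` g10, 2026-08-29; pen word S39-35 «re-cut ACCEPTED IN SHAPE»): K0₂@p is RE-CUT —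
# `stub_heckeThetaPartner_ns` now WITHOUT its level clause (conclusion shape of the landed socket
# `SmallImageLambdaLowerThreeNsThetaPartner.heckeThetaPartner_classwide_of_arithmeticHalf`; PROVED class-wide by the
# kernel chain AH1a–c + R6 of g9/g10 once `…ThetaPartnerSansLevel` lands — then this stub is discharged BY NAME), plus
# ONE cite stub `stub_levelInputs_rtt` (Deligne's `ρ_{g,ι}`: Hida 2000 Thm 3.26 (1); Carayol 1986 Thm (A) conductor =
# level; Saito 1988 at residue characteristic 2 — Literature named facts BY NAME, VARIANT-N shape — never bare binders
# on `_of`) and ONE content stub `stub_levelMatch_ns` (those three facts ⟹ the level clause `max 2 (v_ℓ M) = max 2 (v_ℓ N_W)`, `ℓ ≠ p`, for EVERY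
# `Γ₀(M)` weight-2 partner congruent to `W` off `p·M·N_W`: `ρ̄_g ≅ ρ̄_W` irreducible, equal Swan conductors at
# `ℓ ≠ p`, `V^{P_ℓ} ∈ {0, V}` by the determinant, so the exponents agree above `2` and are both `≤ 2` otherwise).
# Glue `heckeThetaPartner_levelMatched_of_stubs` recovers v1's K0₂ text VERBATIM; `stub_publishedInputs_rtt`,
# `stub_muOneSign_ns_ge5`, `stub_thetaLayerLambda_ns`, `stub_residualThetaMC_ns` are BYTE-IDENTICAL to v1; 7 stubs;
# composition `SmallImageLowerHalfBothSigns_of` still concludes the crux BY NAME through the landed part-4 theorem.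
# NOT registered by this seat (registration = pen / LEAD, `skeleton check --crux stmt-BirchSwinnertonDyer-23599`).
#
# Line `rtt` — PROPOSAL `Lines/rtt_w3.lean` (width seat `bsd-line-slh-p3-w3` g8, 2026-08-29) — child L
# `SmallImageLowerHalfBothSigns` (item stmt-BirchSwinnertonDyer-23599): RESIDUAL THETA TRANSPORT from a CM NEWFORM at
# every odd `p` — the `p`-twin of route `ResidualThetaTransportAtTwo` (READY, rev 40) on crux L's small-image class.
# NOT registered by this seat (L1 is the LEAD's; by director (370)(iv) the K3 pen registers BY DELEGATION when its
# conditions (i)–(iii) hold). Card: `Lines/rtt_w3.md`. Memo: `Lines/birth_acns-MEMO-w3-g8.md`.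

THE LINE. On the class (`p` odd, `ClassX7 W p`, non-CM, `a_p = 0`, `¬ Surj W p`: mod-`p` image in `N(C_ns(p))`, so
`ρ̄_{E,p} ≅ Ind_K χ̄` with `K` imaginary quadratic and `p` INERT in `K` — kernel `…SmallImageShadowInert`) there is a
LEVEL-MATCHED CM NEWFORM partner `g = θ_ψ`, `a_p(g) = 0` (K0₂); the signed main conjecture for `W` at the floor's sign
then follows from (Kan₂) the layer-λ equality of the `S₀`-depleted Mazur–Tate elements of `W` and `g` (Vatsal 1999 =
tree fact `vatsal1999_plusSymbol_congruence`, Condition 1 automatic under the level clause; Pollack 2003), (Kλ₂) the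
residual λ-formula + residual theta count (Greenberg–Vatsal (10), B. D. Kim 2009, Hatley–Lei 2019 Thm 4.6, and the
λ-part of the signed MC for the CM form `g` at the inert prime: Pollack–Rubin 2004 / JLK 2011 Thm 5.2 ⊕ Kato §15 ⊕
Lei 2011 Cor 6.9 — ARM-P sheet U-r02-AP: PRINT-COMPOSITE, 0 GAP, carry clauses (C-S2), (C-S6/S7) on the card), the
one-sign analytic `μ`-floor (23117 at `p ≥ 5`; THEOREM B at `p = 3`, input-free) with lane B's `μ`-brick, Kato's
RATIONAL divisibility (`h41`) and Kobayashi's control (`h12`) — composition = the LANDED by-name theorem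
`SmallImageLambdaLowerThreeNsThetaTransport.smallImageLowerHalfBothSigns_of_oneSignFloor_of_rtt` (parts 1–4,
`Theorems/…LambdaLowerThreeNsThetaTransport{Core,,Three,Crux}.lean`).

Stubs (v1 count; v2 = 7, see top): 5 = `stub_publishedInputs_rtt` (HELD print: hJ ∧ h12 ∧ h41 ∧ h5 ∧ h3; never a prover target),
`stub_muOneSign_ns_ge5` (= line `birth_acns` v15's stub VERBATIM = retired 23117; conjecture-grade; the ONE non-print
input), `stub_heckeThetaPartner_ns` (K0₂@p ∀ odd p — port of RTT's K0⁺ machinery ≈ 40 files at 2, with the CFT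
existence theorem `HeckeThetaPartner.exists_isGrossencharakter_embType` and `HeckeTheta.ribet_cmNewform_gamma0_two`
already in tree; size L), `stub_thetaLayerLambda_ns` (Kan₂@p — Vatsal typed fact + depletion / layer plumbing; size M),
`stub_residualThetaMC_ns` (Kλ₂@p = RLF ∧ RMC; size XL — the ENGINE; HARDEST). Composition
`SmallImageLowerHalfBothSigns_of` concludes child L BY NAME; sorries only in the 5 stubs. Versus `birth_acns` v15
(7 stubs): NO two-variable Euler-system engine (`stub_ES2rat_ns`, `stub_acDivRat_ns`), NO preprint binder
(`stub_preprintInputs_ns`), and the `p = 3` λ-stub `stub_lambdaLowerThree_ns` is ABSORBED (part 3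
`stub_lambdaLowerThree_ns_of_rtt`). HONEST: child L, crux 4 and BSD are OPEN / not proved by this seat; the three
K-stubs are print-composite and NOT typed.
-/

set_option autoImplicit false
set_option linter.dupNamespace false
noncomputable section

open scoped Classical MatrixGroups ModularForm BigOperators

namespace Summit.BirchSwinnertonDyer.BirchSwinnertonDyer.Cruxes.SmallImageLowerHalfBothSigns.Rtt

open CongruenceSubgroup WeierstrassCurve Field Polynomial NumberField IsDedekindDomain
  Literature.NumberTheory.EllipticCurves Literature.NumberTheory.EllipticCurves.ModularForms
  Literature.NumberTheory.EllipticCurves.Rank1Residual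
  Literature.NumberTheory.EllipticCurves.Kobayashi2003
  Literature.NumberTheory.EllipticCurves.GreenbergVatsal2000 ZpExtension
  Literature.NumberTheory.IwasawaTheory Rat.HeightOneSpectrum
  Summit.BirchSwinnertonDyer.Rank1Residual.Supersingular
  Summit.BirchSwinnertonDyer.Rank1Residual.X1.MuLambda
  Summit.BirchSwinnertonDyer.BirchSwinnertonDyer.Theorems.SmallImageLambdaLowerThreeNsThetaTransport

/-- stub (HELD, cite-only; never a prover target): Kobayashi 2003 Thm 5.2 iv)/6.2–6.3/7.3 i) JOINT Coleman–Kato package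
(`hJ`), Thm 1.2 (`h12`), Thm 4.1 rational clause (`h41`), and the period-unit facts (`h5`, `h3`: Greenberg–Vatsal §3
Rem 3.4 / Mazur 1978 Cor 4.1). All ACCEPTED Literature named facts of K3's cone. -/
theorem stub_publishedInputs_rtt :
    thm62_63_73_signedColemanKato_zetaJoint ∧ thm12_signedSelmerDual_finite_torsion ∧
      thm41_signedCharIdeal_divisibility ∧ realPeriodRat_eq_unit_mul_plusPeriod ∧
      realPeriodRat_eq_unit_mul_plusPeriod_three := by
  sorry

/-- stub (= line `birth_acns` v15's `stub_muOneSign_ns_ge5` VERBATIM = retired item 23117 `SmallImageOneSignUnitContent`;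
conjecture-grade: Pollack 2003 Conj 6.3 for ONE sign on the residually `K`-dihedral class at `p ≥ 5`; at `p = 3` the
floor is THEOREM B inside part 1 and no stub is needed). -/
theorem stub_muOneSign_ns_ge5 : ∀ (W : WeierstrassCurve ℚ) [W.IsElliptic] [W.IsGloballyMinimal] (p : ℕ) [Fact p.Prime],
    5 ≤ p → ClassX7 W p → ¬ W.HasCM → W.frobeniusTrace p = 0 → ¬ Surj W p →
    ∀ [NeZero (W.conductorNorm ℤ)] (f : CuspForm (Gamma0 (W.conductorNorm ℤ)) 2),
      IsNewformOf W f → ∃ (ε₀ : ℤˣ) (L₀ : IwasawaAlgebra p), IsSignedPAdicLFunction f p ε₀ L₀ ∧ HasUnitContent L₀ := by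
  sorry

/-- stub K0₂@p, v2 = WITHOUT the level clause (pen word S39-35): on the whole class, at every odd `p`, a `p`-adic
Hecke theta partner — a CM newform `g` on `Γ₀(M)`, `p ∤ M`, `a_p(g) = 0`, a cohomological plus period along
`ι : K_g → ℚ̄_p`, congruent to `W` off `p·M·N_W`.  EXACTLY the conclusion of the landed socket
`SmallImageLambdaLowerThreeNsThetaPartner.heckeThetaPartner_classwide_of_arithmeticHalf` (p725917), whose arithmetic
half is the kernel chain of g9 (17 bricks + R6 `heckeThetaPartner_of_inertField`) and g10 (AH1a–c: the dihedral
field `ℚ̄^U` as a totally complex quadratic number field with `res(Γ_K) = U`, the inert place `v = p𝓞_K` with its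
local data, residue embedding, Frobenius, discriminant); discharged BY NAME by `…ThetaPartnerSansLevel` when it lands.
(Hecke 1926 / Shimura; Ribet 1977 §3 — tree `HeckeTheta.ribet_cmNewform_gamma0_two`; CFT — tree
`HeckeThetaPartner.exists_isGrossencharakter_embType`; Serre 1972 §2, §4.2.) -/
theorem stub_heckeThetaPartner_ns : ∀ (W : WeierstrassCurve ℚ) [W.IsElliptic] [W.IsGloballyMinimal] (p : ℕ) [Fact p.Prime],
      p ≠ 2 → ClassX7 W p → ¬ W.HasCM → W.frobeniusTrace p = 0 → ¬ Surj W p →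
      ∃ (M : ℕ) (_ : NeZero M) (g : CuspForm (Gamma0 M) 2) (ι : coeffField g →+* PadicAlgCl p) (Ω : ℂ),
        ¬ p ∣ M ∧ IsNewform0 g ∧ Literature.NumberTheory.Automorphic.IsCMForm (liftToGamma1 M 2 g) ∧
          cuspCoeff g p = 0 ∧ IsCohomologicalPlusPeriod g ι Ω ∧
          (∀ ℓ : ℕ, ℓ.Prime → ¬ ℓ ∣ p * M * W.conductorNorm ℤ →
            ‖embCoeff g ι ℓ - (W.frobeniusTrace ℓ : PadicAlgCl p)‖ < 1) := by
  sorry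

/-- stub (HELD, cite-only; never a prover target): the three printed facts behind the level clause, BY NAME — Deligne's
`p`-adic Galois representation `ρ_{g,ι}` of a newform (Hida 2000 Thm. 3.26 (1); Literature named fact
`Hida2000_thm326_exists_galoisRep`, no `_holds`; it is the carrier Carayol's fact speaks about), Carayol 1986 Thm. (A) (the Artin conductor of the Galois representation of a newform is its level; Literature named
fact `Carayol1986_artinConductorExponent`, no `_holds` yet) and Saito 1988 Thm. 1 at residue characteristic `2`
(the Swan conductor of `V_ℓ E` at an additive place of residue characteristic `2` is Ogg's wild exponent; Literature
named fact `WeierstrassCurve.swanConductorAt_rationalTate_eq_wildConductorExponent_of_ringChar_eq_two`, partial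
discharges `…_of_potentiallyGood` / `…_of_ne_two` in the tree).  Verbatim the binders `hC`, `hS` of the tree's
`IsNewformOf.level_eq_conductorNorm_of_carayol_of_saito'` (`CuspFormLFunctionLevelConductorCarayolProofs`).
[cite: Hida2000, Thm. 3.26 (1), pp. 151–152] [cite: CarayolASENS1986, Thm. (A) with (0.5), (0.8) Corollaire (pp. 410–411)]
[cite: Saito1988, Theorem 1] -/
theorem stub_levelInputs_rtt :
    Hida2000_thm326_exists_galoisRep ∧ Carayol1986_artinConductorExponent ∧
      (∀ (V : WeierstrassCurve ℚ) (ℓ : ℕ) [Fact ℓ.Prime],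
        V.swanConductorAt_rationalTate_eq_wildConductorExponent_of_ringChar_eq_two ℓ) := by
  sorry

/-- stub LEVEL MATCH (content, size M; VARIANT-N: the three printed facts INSIDE the hypothesis list): for every class
pair `(W, p)` and EVERY weight-`2` newform `g` on `Γ₀(M)`, `p ∤ M`, congruent to `W` off `p·M·N_W` (`p`-adically,
along `ι`), the levels match away from `p` up to the tame ambiguity: `max 2 (v_ℓ M) = max 2 (v_ℓ N_W)` for every prime
`ℓ ≠ p` (carry clause (C-S6/S7) of ARM-P sheet U-r02-AP, `max 2` form).  WHY TRUE: the congruence and Brauer–Nesbitt /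
Chebotarev give `ρ̄_{g,ι} ≅ ρ̄_{W,p}` (irreducible on the class); for `ℓ ≠ p` the wild inertia `P_ℓ` acts through a
finite `ℓ`-group injecting under reduction mod `p`, so `sw_ℓ(ρ_g) = sw_ℓ(ρ_W)` and `P_ℓ` acts trivially on one iff on
the other; both determinants are cyclotomic (unramified at `ℓ`), so `V^{P_ℓ}` is `0` or `V`: either both exponents are
`2 + sw_ℓ > 2` and EQUAL, or both are tame `≤ 2`; Carayol identifies the exponent of Deligne's `ρ_g` with `v_ℓ(M)`, Grothendieck /
Ogg–Saito (Saito at `ℓ = 2`) that of `ρ_W = V_p(W)` with `v_ℓ(N_W)`.  (DDT 1995 Thm 3.1 (d); Serre, Corps locaux VI §2;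
Serre–Tate 1968 §3; Livné / Carayol 1989 on conductors mod `p`.) -/
theorem stub_levelMatch_ns : Hida2000_thm326_exists_galoisRep → Carayol1986_artinConductorExponent →
    (∀ (V : WeierstrassCurve ℚ) (ℓ : ℕ) [Fact ℓ.Prime],
      V.swanConductorAt_rationalTate_eq_wildConductorExponent_of_ringChar_eq_two ℓ) →
    ∀ (W : WeierstrassCurve ℚ) [W.IsElliptic] [W.IsGloballyMinimal] (p : ℕ) [Fact p.Prime],
      p ≠ 2 → ClassX7 W p → ¬ W.HasCM → W.frobeniusTrace p = 0 → ¬ Surj W p →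
      ∀ (M : ℕ) [NeZero M] (g : CuspForm (Gamma0 M) 2) (ι : coeffField g →+* PadicAlgCl p),
        ¬ p ∣ M → IsNewform0 g → Literature.NumberTheory.Automorphic.IsCMForm (liftToGamma1 M 2 g) →
        (∀ ℓ : ℕ, ℓ.Prime → ¬ ℓ ∣ p * M * W.conductorNorm ℤ →
          ‖embCoeff g ι ℓ - (W.frobeniusTrace ℓ : PadicAlgCl p)‖ < 1) →
        ∀ ℓ : ℕ, ℓ.Prime → ℓ ≠ p → max 2 (padicValNat ℓ M) = max 2 (padicValNat ℓ (W.conductorNorm ℤ)) := by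
  sorry

/-- glue (no sorry): v1's LEVEL-MATCHED K0₂@p text VERBATIM from the two v2 stubs and the cite stub's facts. -/
theorem heckeThetaPartner_levelMatched_of_stubs (hD : Hida2000_thm326_exists_galoisRep)
    (hC : Carayol1986_artinConductorExponent)
    (hS : ∀ (V : WeierstrassCurve ℚ) (ℓ : ℕ) [Fact ℓ.Prime],
      V.swanConductorAt_rationalTate_eq_wildConductorExponent_of_ringChar_eq_two ℓ) :
    ∀ (W : WeierstrassCurve ℚ) [W.IsElliptic] [W.IsGloballyMinimal] (p : ℕ) [Fact p.Prime],
      p ≠ 2 → ClassX7 W p → ¬ W.HasCM → W.frobeniusTrace p = 0 → ¬ Surj W p →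
      ∃ (M : ℕ) (_ : NeZero M) (g : CuspForm (Gamma0 M) 2) (ι : coeffField g →+* PadicAlgCl p) (Ω : ℂ),
        ¬ p ∣ M ∧ (∀ ℓ : ℕ, ℓ.Prime → ℓ ≠ p → max 2 (padicValNat ℓ M) = max 2 (padicValNat ℓ (W.conductorNorm ℤ))) ∧
          IsNewform0 g ∧ Literature.NumberTheory.Automorphic.IsCMForm (liftToGamma1 M 2 g) ∧
          cuspCoeff g p = 0 ∧ IsCohomologicalPlusPeriod g ι Ω ∧
          (∀ ℓ : ℕ, ℓ.Prime → ¬ ℓ ∣ p * M * W.conductorNorm ℤ →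
            ‖embCoeff g ι ℓ - (W.frobeniusTrace ℓ : PadicAlgCl p)‖ < 1) := by
  intro W _ _ p _ hp hX hcm hap hs
  obtain ⟨M, hM, g, ι, Ω, hpM, hnew, hcmf, hapg, hΩ, hcong⟩ := stub_heckeThetaPartner_ns W p hp hX hcm hap hs
  haveI := hM
  exact ⟨M, hM, g, ι, Ω, hpM, stub_levelMatch_ns hD hC hS W p hp hX hcm hap hs M g ι hpM hnew hcmf hcong, hnew, hcmf,
    hapg, hΩ, hcong⟩

/-- stub Kan₂@p (LEVEL-MATCHED twin of RTT's Kan⁺ `ThetaLayerLambdaCongruenceAtTwo`, item 20688): for a level-matched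
partner datum, the conductor-level newform `f`, an admissible `S₀ ∌ p` and a Pollack pair whose sign-`ε` member has
unit content, the `S₀`-depleted layer Mazur–Tate elements of `W` and of `g` have equal layer-`λ` for `n ≫ 0` of the
parity of `ε` (Vatsal 1999 (1.6)/(1.13) = tree fact `vatsal1999_plusSymbol_congruence` — its Condition 1 for the
depleted pair is AUTOMATIC under the level clause (sheet §4 (a)); Pollack 2003 Prop 6.18; RTT layer algebra). -/
theorem stub_thetaLayerLambda_ns : ∀ (W : WeierstrassCurve ℚ) [W.IsElliptic] [W.IsGloballyMinimal] (p : ℕ) [Fact p.Prime],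
      p ≠ 2 → ClassX7 W p → ¬ W.HasCM → W.frobeniusTrace p = 0 → ¬ Surj W p →
      ∀ (ε : ℤˣ), ∀ (M : ℕ) [NeZero M] (g : CuspForm (Gamma0 M) 2) (ι : coeffField g →+* PadicAlgCl p) (Ω : ℂ),
        ¬ p ∣ M → (∀ ℓ : ℕ, ℓ.Prime → ℓ ≠ p → max 2 (padicValNat ℓ M) = max 2 (padicValNat ℓ (W.conductorNorm ℤ))) →
        IsNewform0 g → Literature.NumberTheory.Automorphic.IsCMForm (liftToGamma1 M 2 g) →
        cuspCoeff g p = 0 → IsPlusPeriod g Ω →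
        (∀ ℓ : ℕ, ℓ.Prime → ¬ ℓ ∣ p * M * W.conductorNorm ℤ →
          ‖embCoeff g ι ℓ - (W.frobeniusTrace ℓ : PadicAlgCl p)‖ < 1) →
        ∀ [NeZero (W.conductorNorm ℤ)] (f : CuspForm (Gamma0 (W.conductorNorm ℤ)) 2), IsNewformOf W f →
        ∀ (Lplus Lminus : IwasawaAlgebra p), IsPollackPair f p Lplus Lminus →
          HasUnitContent (kobayashiL ε Lplus Lminus) →
        ∀ (S₀ : Finset (HeightOneSpectrum (𝓞 ℚ))), (∀ v ∈ S₀, ((p : ℕ) : 𝓞 ℚ) ∉ v.asIdeal) →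
          (∀ v : HeightOneSpectrum (𝓞 ℚ), ¬ W.HasGoodReductionAt v → v ∈ S₀) →
          (∀ v : HeightOneSpectrum (𝓞 ℚ), natGenerator v ∣ M → v ∈ S₀) →
        ∃ n₀ : ℕ, ∀ n ≥ n₀, (Even n ↔ ε = 1) →
          layerLambda (((mazurTateElement f p n).map (algebraMap ℚ (PadicAlgCl p)) *
              ∏ v ∈ S₀, ((W.localPolynomialAt v).map (Int.castRingHom (PadicAlgCl p))).comp
                (C ((natGenerator v : PadicAlgCl p)⁻¹) *
                  (X + 1) ^ (PadicInt.toZModPow n (-(frobeniusExponent p (natGenerator v : ℤ_[p])))).val)) %ₘ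
              ((X + 1) ^ p ^ n - 1)) =
          layerLambda (((mazurTateElementK g Ω p n).map ι *
              ∏ v ∈ S₀, (1 - C (embCoeff g ι (natGenerator v)) * X +
                  (if natGenerator v ∣ M then 0 else C (natGenerator v : PadicAlgCl p)) * X ^ 2).comp
                (C ((natGenerator v : PadicAlgCl p)⁻¹) *
                  (X + 1) ^ (PadicInt.toZModPow n (-(frobeniusExponent p (natGenerator v : ℤ_[p])))).val)) %ₘ
              ((X + 1) ^ p ^ n - 1)) := by
  sorry

/-- stub Kλ₂@p (LEVEL-MATCHED twin of RTT's Kλ⁺ `ResidualThetaMainConjectureAtTwo`, item 20787 = RLF 23110 ∧ RMC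
24195): residual λ-formula + residual theta count — Greenberg–Vatsal (10) / Prop (2.8), B. D. Kim 2009 Cor 2.13, Kobayashi
Thm 1.2, Hatley–Lei 2019 Thm 4.6 (odd `p`, `k = 2 ≤ p`), and the λ-part of the signed main conjecture for the CM form
`g` at the inert prime (Pollack–Rubin 2004 for CM curves over ℚ; Johnson-Leung–Kings 2011 Thm 5.2 ⊕ Kato §15 ⊕ Lei
2011 Cor 6.9 in general; carry clause (C-S2) = the Det-descent `Λ_𝒪(ℤ_p²) → Λ_cyc` paragraph, sheet §2 (J1)–(J5)). The
ENGINE of the line; HARDEST stub. -/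
theorem stub_residualThetaMC_ns : ∀ (W : WeierstrassCurve ℚ) [W.IsElliptic] [W.IsGloballyMinimal] (p : ℕ) [Fact p.Prime],
      p ≠ 2 → ClassX7 W p → ¬ W.HasCM → W.frobeniusTrace p = 0 → ¬ Surj W p →
      ∀ (ε : ℤˣ), ∀ (M : ℕ) [NeZero M] (g : CuspForm (Gamma0 M) 2) (ι : coeffField g →+* PadicAlgCl p) (Ω : ℂ),
        ¬ p ∣ M → (∀ ℓ : ℕ, ℓ.Prime → ℓ ≠ p → max 2 (padicValNat ℓ M) = max 2 (padicValNat ℓ (W.conductorNorm ℤ))) →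
        IsNewform0 g → Literature.NumberTheory.Automorphic.IsCMForm (liftToGamma1 M 2 g) →
        cuspCoeff g p = 0 → IsPlusPeriod g Ω →
        (∀ ℓ : ℕ, ℓ.Prime → ¬ ℓ ∣ p * M * W.conductorNorm ℤ →
          ‖embCoeff g ι ℓ - (W.frobeniusTrace ℓ : PadicAlgCl p)‖ < 1) →
        ∀ (κ : ZpExtension ℚ p) (γ : absoluteGaloisGroup ℚ),
          κ.IsCyclotomic → κ.IsTopGenerator γ → IsCyclotomicVariable p γ →
        ∀ [NeZero (W.conductorNorm ℤ)] (f : CuspForm (Gamma0 (W.conductorNorm ℤ)) 2), IsNewformOf W f →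
        ∀ (ϖ : ℚ), (ϖ : ℝ) * W.realPeriodRat = plusPeriod f →
        ∀ (Lplus Lminus : IwasawaAlgebra p), IsPollackPair f p Lplus Lminus →
        ∀ (S₀ : Finset (HeightOneSpectrum (𝓞 ℚ))), (∀ v ∈ S₀, ((p : ℕ) : 𝓞 ℚ) ∉ v.asIdeal) →
          (∀ v : HeightOneSpectrum (𝓞 ℚ), ¬ W.HasGoodReductionAt v → v ∈ S₀) →
          (∀ v : HeightOneSpectrum (𝓞 ℚ), natGenerator v ∣ M → v ∈ S₀) →
        ∀ (D : SignedSelmerDualData W κ γ ε) [Module.Finite (IwasawaAlgebra p) D.X],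
          Module.IsTorsion (IwasawaAlgebra p) D.X → D.mu = 0 →
        ∀ (G : IwasawaAlgebra p) (m : ℕ),
          iwasawaToPowerSeries p G =
            PowerSeries.C ((p : ℚ_[p]) ^ m * (ϖ : ℚ_[p])) * iwasawaToPowerSeries p (kobayashiL ε Lplus Lminus) →
        ∃ n₀ : ℕ, ∀ n ≥ n₀, (Even n ↔ ε = 1) →
          ((lambdaInvariant p D.X : ℕ) : ℤ) - ((lam G : ℕ) : ℤ) =
            ((layerLambda (((mazurTateElementK g Ω p n).map ι *
              ∏ v ∈ S₀, (1 - C (embCoeff g ι (natGenerator v)) * X +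
                  (if natGenerator v ∣ M then 0 else C (natGenerator v : PadicAlgCl p)) * X ^ 2).comp
                (C ((natGenerator v : PadicAlgCl p)⁻¹) *
                  (X + 1) ^ (PadicInt.toZModPow n (-(frobeniusExponent p (natGenerator v : ℤ_[p])))).val)) %ₘ
              ((X + 1) ^ p ^ n - 1)) : ℕ) : ℤ) -
            ((layerLambda (((mazurTateElement f p n).map (algebraMap ℚ (PadicAlgCl p)) *
              ∏ v ∈ S₀, ((W.localPolynomialAt v).map (Int.castRingHom (PadicAlgCl p))).comp
                (C ((natGenerator v : PadicAlgCl p)⁻¹) *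
                  (X + 1) ^ (PadicInt.toZModPow n (-(frobeniusExponent p (natGenerator v : ℤ_[p])))).val)) %ₘ
              ((X + 1) ^ p ^ n - 1)) : ℕ) : ℤ) := by
  sorry

/-- composition = THE SKELETON: child L `SmallImageLowerHalfBothSigns` BY NAME from the seven stubs (v2: K0₂ sans level
clause + cite stub + level match, glued to v1's K0₂ text by `heckeThetaPartner_levelMatched_of_stubs`), through the
landed by-name theorem `smallImageLowerHalfBothSigns_of_oneSignFloor_of_rtt` (parts 1–4). No sorry of its own.
[cite: Kobayashi2003, Conjecture (Main Conjecture) (p. 2), Thm. 7.4 (p. 13)] [cite: PollackWeston2011MT, §3.1, Thm. 4.1] -/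
theorem SmallImageLowerHalfBothSigns_of :
    Summit.BirchSwinnertonDyer.BirchSwinnertonDyer.Theses.SignedLowerHalves.SmallImageLowerHalfBothSigns := by
  obtain ⟨hJ, h12, h41, h5, h3⟩ := stub_publishedInputs_rtt
  obtain ⟨hD, hC, hS⟩ := stub_levelInputs_rtt
  exact smallImageLowerHalfBothSigns_of_oneSignFloor_of_rtt hJ h12 h41 h5 h3 stub_muOneSign_ns_ge5
    (heckeThetaPartner_levelMatched_of_stubs hD hC hS) stub_thetaLayerLambda_ns stub_residualThetaMC_ns

end Summit.BirchSwinnertonDyer.BirchSwinnertonDyer.Cruxes.SmallImageLowerHalfBothSigns.Rtt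

end
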